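import Summits.BirchSwinnertonDyer.BirchSwinnertonDyer.Theorems.ResidualThetaTransportAtTwoThetaLayerLambdaCongruenceAtTwoStarEigenform
import Summits.BirchSwinnertonDyer.BirchSwinnertonDyer.Theorems.ResidualThetaTransportAtTwoThetaLayerLambdaCongruenceAtTwoStarRhombicLattice
import HarnessLib

/-!
# Crux `ThetaLayerLambdaCongruenceAtTwo` (stmt-BirchSwinnertonDyer-20688, route ResidualThetaTransportAtTwo), line
# `birth` v9, stub (C3k), plan ITEM B5: THE BRIDGE — `c ≠ 1` on `Λ/𝔪Λ` from `Δ_W < 0` through a real, odd-index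
# chain of lattices `Λ_W ⟶ Λ_A = c·Λ_g` (width seat bsd-wall-rtt-p3-w3 g3; `--supports stmt-BirchSwinnertonDyer-20688
# --as helper`; closes nothing)

HONEST FRAMING. A THEOREM with its two arithmetic inputs as EXPLICIT HYPOTHESES in the tree's vocabulary (no named
fact is introduced here): nothing is asserted about the existence of the optimal quotient or of the isogeny. BSD is
not proved by any of this.

WHAT (`exists_periodFunctional_iotaConj_add_notMem_of_latticeBridge`). Data: an elliptic curve `W/ℚ` with
`Δ_W < 0` and a Néron period pair `L_W` of `W ⊗ ℂ`; a cusp form `g ∈ S₂(Γ₀(M))` with real Fourier coefficients and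
an ideal `𝔪 ⊆ 𝕋 = HeckeRing0 M 2` acting on `g` by even integers (the depleted eigenform and its eigen-ideal
`(2, T_q − a_q(W), U_ℓ)`); and the BRIDGE:
* (H1) a subgroup `B ≤ ℂ` which is a nonzero REAL multiple of the period lattice of `g`, `B = c·Λ_g` — in the
  application `B` is the Néron lattice of the optimal quotient `A = J₀(M)/I_g J₀(M)` attached to `g`, an elliptic
  curve over `ℚ` with `A(ℂ) = ℂ/Λ_g` (Agashe–Ribet–Stein 2006 §2–3, §5; Shimura 1971 Thm. 7.14–7.15; Cremona 1997
  §2.6);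
* (H2) a nonzero REAL `α` and an ODD `m` with `αΛ_W ⊆ B` and `m·B ⊆ αΛ_W` — in the application the multiplier
  of a cyclic `ℚ`-isogeny `W → A` of odd degree `m` (odd because `W`, good supersingular at `2`, has no rational
  `2`-torsion; sibling `…StarOddIsogeny`).
Conclusion: some `γ ∈ Γ₀(M)` has `{∞,(εγε)∞} + {∞,γ∞} ∉ 𝔪 • Λ` — complex conjugation is NOT the identity on
`Λ/𝔪Λ` (ITEM B5). Proof: `Λ_W` rhombic (`neronLattice_rhombic_of_Δ_neg`) ⇒ `αΛ_W` rhombic (real scaling) ⇒ `B`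
rhombic (odd-index ascent) ⇒ `Λ_g` rhombic (real scaling) ⇒ spine (`…StarEigenform`).
Also the RECTANGULAR control statement (`forall_apply_add_conj_mem_of_latticeBridge_of_Δ_pos`): with `Δ_W > 0`
the same bridge makes `Λ_g` rectangular, so `ev_g` cannot detect `c ≠ 1` — consistent with (C3k) being false for
`Δ_W > 0` (plan, B5).

References: [CremonaAlgorithms1997] §2.6, §2.10; [AgasheRibetStein2006] §2–3, §5; [Shimura1971] Thm. 7.14–7.15;
[SilvermanAEC2009] VI.4.1, VI.5.3.
-/

noncomputable section

-- justification: the `Summit.BirchSwinnertonDyer.BirchSwinnertonDyer.…` path repeats a component (route-file convention)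
set_option linter.dupNamespace false

open scoped MatrixGroups ComplexConjugate

open CongruenceSubgroup Complex
open Literature.NumberTheory.EllipticCurves Literature.NumberTheory.EllipticCurves.ModularForms

namespace Summit.BirchSwinnertonDyer.BirchSwinnertonDyer.Theorems.ThetaLayerLambdaCongruenceAtTwo

section Bridge

variable {M : ℕ} [NeZero M]

omit [NeZero M] in
/-- Transport of rhombicity along the bridge: `Λ_W` rhombic, `αΛ_W ⊆ B`, `m·B ⊆ αΛ_W` (`α ∈ ℝ^×`, `m` odd),
`B = c·Λ_g` (`c ∈ ℝ^×`), `Λ_W` conjugation-stable ⇒ `Λ_g` rhombic. [folklore] -/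
theorem periodLattice_rhombic_of_latticeBridge (g : CuspForm (Gamma0 M) 2)
    {LW : PeriodPair} (hLWreal : LW.IsReal) (hrh : ∃ z ∈ LW.lattice, ∀ w ∈ LW.lattice, z + conj z ≠ 2 * w)
    (B : AddSubgroup ℂ) {c : ℝ} (hc : c ≠ 0) (hB : ∀ z, z ∈ B ↔ ∃ w ∈ periodLattice g, z = (c : ℂ) * w)
    {α : ℝ} (hα : α ≠ 0) {m : ℕ} (hm : Odd m) (hWB : ∀ z ∈ LW.lattice, (α : ℂ) * z ∈ B)
    (hBW : ∀ b ∈ B, ∃ z ∈ LW.lattice, (m : ℂ) * b = (α : ℂ) * z) :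
    ∃ z ∈ periodLattice g, ∀ w ∈ periodLattice g, z + conj z ≠ 2 * w := by
  -- `αΛ_W` as a subgroup
  set B₁ : AddSubgroup ℂ := (LW.lattice.toAddSubgroup).map (AddMonoidHom.mulLeft (α : ℂ)) with hB₁
  have hB₁mem : ∀ z, z ∈ B₁ ↔ ∃ a ∈ LW.lattice.toAddSubgroup, z = (α : ℂ) * a := fun z ↦ by
    simp only [hB₁, AddSubgroup.mem_map, AddMonoidHom.coe_mulLeft]
    exact ⟨fun ⟨a, ha, e⟩ ↦ ⟨a, ha, e.symm⟩, fun ⟨a, ha, e⟩ ↦ ⟨a, ha, e.symm⟩⟩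
  -- step 1: `αΛ_W` rhombic
  have h1 : ∃ z ∈ B₁, ∀ w ∈ B₁, z + conj z ≠ 2 * w :=
    rhombic_of_rhombic_real_mul (A := LW.lattice.toAddSubgroup) hα hB₁mem hrh
  -- step 2: `B` rhombic (odd-index ascent)
  have hB₁B : B₁ ≤ B := fun z hz ↦ by
    obtain ⟨a, ha, rfl⟩ := (hB₁mem z).mp hz
    exact hWB a ha
  have hB₁conj : ∀ z ∈ B₁, conj z ∈ B₁ := fun z hz ↦ by
    obtain ⟨a, ha, rfl⟩ := (hB₁mem z).mp hz
    exact (hB₁mem _).mpr ⟨conj a, hLWreal a ha, by rw [map_mul, Complex.conj_ofReal]⟩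
  have hmB : ∀ b ∈ B, (m : ℂ) * b ∈ B₁ := fun b hb ↦ by
    obtain ⟨z, hz, e⟩ := hBW b hb
    exact (hB₁mem _).mpr ⟨z, hz, e⟩
  have h2 : ∃ z ∈ B, ∀ w ∈ B, z + conj z ≠ 2 * w := rhombic_of_rhombic_sub_of_odd_index hB₁B hB₁conj hm hmB h1
  -- step 3: `Λ_g` rhombic (real scaling by `c⁻¹`)
  exact (rhombic_iff_real_mul (A := periodLattice g) hc hB).mpr h2

/-- **ITEM B5 through the lattice bridge.** `W/ℚ` with `Δ_W < 0`, `L_W` a Néron period pair of `W ⊗ ℂ`;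
`g ∈ S₂(Γ₀(M))` with real coefficients, `𝔪 ⊆ 𝕋` acting on `g` by even integers; (H1) `B = c·Λ_g`, `c ∈ ℝ^×`;
(H2) `αΛ_W ⊆ B`, `m·B ⊆ αΛ_W`, `α ∈ ℝ^×`, `m` odd. Then complex conjugation is not the identity on `Λ/𝔪Λ`:
some `γ ∈ Γ₀(M)` has `{∞,(εγε)∞} + {∞,γ∞} ∉ 𝔪 • Λ`. [cite: CremonaAlgorithms1997, §2.10 (pp. 29–30)] -/
theorem exists_periodFunctional_iotaConj_add_notMem_of_latticeBridge (W : WeierstrassCurve ℚ) (hΔ : W.Δ < 0)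
    {LW : PeriodPair} (hLW : IsNeronLatticeOf (W.baseChange ℂ) LW)
    (g : CuspForm (Gamma0 M) 2) (hreal : ∀ n, (cuspCoeff g n).im = 0) (𝔪 : Ideal (HeckeRing0 M 2))
    (h𝔪 : ∀ t ∈ 𝔪, ∃ e : ℤ, HeckeRing0.toEnd M 2 t g = ((2 * e : ℤ) : ℂ) • g)
    (B : AddSubgroup ℂ) {c : ℝ} (hc : c ≠ 0) (hB : ∀ z, z ∈ B ↔ ∃ w ∈ periodLattice g, z = (c : ℂ) * w)
    {α : ℝ} (hα : α ≠ 0) {m : ℕ} (hm : Odd m) (hWB : ∀ z ∈ LW.lattice, (α : ℂ) * z ∈ B)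
    (hBW : ∀ b ∈ B, ∃ z ∈ LW.lattice, (m : ℂ) * b = (α : ℂ) * z) :
    ∃ γ : Gamma0 M, periodFunctional M ⟨iotaConj (γ : SL(2, ℤ)), iotaConj_coe_mem_gamma0 γ⟩ + periodFunctional M γ ∉
      𝔪 • periodHomologyHecke M :=
  exists_periodFunctional_iotaConj_add_notMem_ideal_smul g hreal 𝔪 h𝔪
    (periodLattice_rhombic_of_latticeBridge g (WeierstrassCurve.isReal_of_g₂_g₃_eq (K := ℚ) hLW.1 hLW.2)
      (W.neronLattice_rhombic_of_Δ_neg hΔ hLW) B hc hB hα hm hWB hBW)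

/-- The `𝔪 • ⊤` spelling of `exists_periodFunctional_iotaConj_add_notMem_of_latticeBridge`.
[cite: CremonaAlgorithms1997, §2.10 (pp. 29–30)] -/
theorem exists_periodFunctional_iotaConj_add_notMem_top_of_latticeBridge (W : WeierstrassCurve ℚ) (hΔ : W.Δ < 0)
    {LW : PeriodPair} (hLW : IsNeronLatticeOf (W.baseChange ℂ) LW)
    (g : CuspForm (Gamma0 M) 2) (hreal : ∀ n, (cuspCoeff g n).im = 0) (𝔪 : Ideal (HeckeRing0 M 2))
    (h𝔪 : ∀ t ∈ 𝔪, ∃ e : ℤ, HeckeRing0.toEnd M 2 t g = ((2 * e : ℤ) : ℂ) • g)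
    (B : AddSubgroup ℂ) {c : ℝ} (hc : c ≠ 0) (hB : ∀ z, z ∈ B ↔ ∃ w ∈ periodLattice g, z = (c : ℂ) * w)
    {α : ℝ} (hα : α ≠ 0) {m : ℕ} (hm : Odd m) (hWB : ∀ z ∈ LW.lattice, (α : ℂ) * z ∈ B)
    (hBW : ∀ b ∈ B, ∃ z ∈ LW.lattice, (m : ℂ) * b = (α : ℂ) * z) :
    ∃ γ : Gamma0 M, (⟨periodFunctional M ⟨iotaConj (γ : SL(2, ℤ)), iotaConj_coe_mem_gamma0 γ⟩ + periodFunctional M γ,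
        add_mem ((mem_periodHomologyHecke M).mpr (periodFunctional_mem_periodHomology M _))
          ((mem_periodHomologyHecke M).mpr (periodFunctional_mem_periodHomology M γ))⟩ : periodHomologyHecke M) ∉
      𝔪 • (⊤ : Submodule (HeckeRing0 M 2) (periodHomologyHecke M)) :=
  exists_periodFunctional_iotaConj_add_notMem_ideal_smul_top g hreal 𝔪 h𝔪
    (periodLattice_rhombic_of_latticeBridge g (WeierstrassCurve.isReal_of_g₂_g₃_eq (K := ℚ) hLW.1 hLW.2)
      (W.neronLattice_rhombic_of_Δ_neg hΔ hLW) B hc hB hα hm hWB hBW)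

/-- **Control statement (`Δ_W > 0`).** With the same bridge but `Δ_W > 0`, the period lattice of `g` is
RECTANGULAR: every `z ∈ Λ_g` has `z + z̄ ∈ 2Λ_g`, so evaluation at `g` sees complex conjugation acting trivially
mod `2` — the reason (C3k) is false for `Δ_W > 0` (plan ITEM B5). [cite: CremonaAlgorithms1997, §2.10 (pp. 29–30)] -/
theorem forall_apply_add_conj_mem_of_latticeBridge_of_Δ_pos (W : WeierstrassCurve ℚ) (hΔ : 0 < W.Δ)
    {LW : PeriodPair} (hLW : IsNeronLatticeOf (W.baseChange ℂ) LW)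
    (g : CuspForm (Gamma0 M) 2) (hreal : ∀ n, (cuspCoeff g n).im = 0)
    (B : AddSubgroup ℂ) {c : ℝ} (hc : c ≠ 0) (hB : ∀ z, z ∈ B ↔ ∃ w ∈ periodLattice g, z = (c : ℂ) * w)
    {α : ℝ} (hα : α ≠ 0) {m : ℕ} (hm : Odd m) (hWB : ∀ z ∈ LW.lattice, (α : ℂ) * z ∈ B)
    (hBW : ∀ b ∈ B, ∃ z ∈ LW.lattice, (m : ℂ) * b = (α : ℂ) * z) :
    ∀ z ∈ periodLattice g, ∃ w ∈ periodLattice g, z + conj z = 2 * w := by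
  have hLWreal : LW.IsReal := WeierstrassCurve.isReal_of_g₂_g₃_eq (K := ℚ) hLW.1 hLW.2
  have hrect := W.neronLattice_rectangular_of_Δ_pos hΔ hLW
  -- if `Λ_g` were rhombic, so would be `Λ_W` (run the bridge backwards)
  intro z hz
  by_contra hcon
  have hg : ∃ z ∈ periodLattice g, ∀ w ∈ periodLattice g, z + conj z ≠ 2 * w :=
    ⟨z, hz, fun w hw e ↦ hcon ⟨w, hw, e⟩⟩
  -- `B` rhombic
  have h2 : ∃ z ∈ B, ∀ w ∈ B, z + conj z ≠ 2 * w := (rhombic_iff_real_mul (A := periodLattice g) hc hB).mp hg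
  -- `αΛ_W` rhombic (odd-index descent; `B` is conjugation-stable)
  set B₁ : AddSubgroup ℂ := (LW.lattice.toAddSubgroup).map (AddMonoidHom.mulLeft (α : ℂ)) with hB₁
  have hB₁mem : ∀ z, z ∈ B₁ ↔ ∃ a ∈ LW.lattice.toAddSubgroup, z = (α : ℂ) * a := fun z ↦ by
    simp only [hB₁, AddSubgroup.mem_map, AddMonoidHom.coe_mulLeft]
    exact ⟨fun ⟨a, ha, e⟩ ↦ ⟨a, ha, e.symm⟩, fun ⟨a, ha, e⟩ ↦ ⟨a, ha, e.symm⟩⟩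
  have hB₁B : B₁ ≤ B := fun z hz ↦ by
    obtain ⟨a, ha, rfl⟩ := (hB₁mem z).mp hz
    exact hWB a ha
  have hBconj : ∀ z ∈ B, conj z ∈ B := fun z hz ↦ by
    obtain ⟨w, hw, rfl⟩ := (hB z).mp hz
    exact (hB _).mpr ⟨conj w, conj_mem_periodLattice_of_real g hreal hw, by rw [map_mul, Complex.conj_ofReal]⟩
  have hmB : ∀ b ∈ B, (m : ℂ) * b ∈ B₁ := fun b hb ↦ by
    obtain ⟨z, hz, e⟩ := hBW b hb
    exact (hB₁mem _).mpr ⟨z, hz, e⟩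
  have h1 : ∃ z ∈ B₁, ∀ w ∈ B₁, z + conj z ≠ 2 * w := rhombic_of_rhombic_of_odd_index hB₁B hBconj hm hmB h2
  -- `Λ_W` rhombic: contradiction with rectangularity
  obtain ⟨z₀, hz₀, hz₀w⟩ := (rhombic_iff_real_mul (A := LW.lattice.toAddSubgroup) hα hB₁mem).mpr h1
  obtain ⟨w₀, hw₀, e⟩ := hrect z₀ hz₀
  exact hz₀w w₀ hw₀ e

end Bridge

end Summit.BirchSwinnertonDyer.BirchSwinnertonDyer.Theorems.ThetaLayerLambdaCongruenceAtTwo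

end
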